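import Summits.BirchSwinnertonDyer.BirchSwinnertonDyer.Theorems.BiquadraticEisensteinDescentHeegnerTwistCouplingInSupplySymbolicMonskyPatternFreeDoor
import HarnessLib

set_option linter.dupNamespace false -- `Summit.BirchSwinnertonDyer.BirchSwinnertonDyer.Theorems.…` (summit = sub)
set_option autoImplicit false

/-!
# Crux `HeegnerTwistCouplingInSupply` (stmt-BirchSwinnertonDyer-21381) — the base Laplacian's TRANSPOSE IDENTITY and the LEFT-KERNEL pairing:
# a virtual kernel pair `(u¹, w¹)` of the base kills the base equations of EVERY vector

Route `BiquadraticEisensteinDescent` (cell `pub/bsd-wall`, width seat `bsd-wall-cm-bed-w3` g21; `--supports` 21381, helper). Tool file for the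
existence side of the w3 g21 memo PATTERN-FREE-STRUCTURE (§1: `Λ* ≅ ker N_B`; §5b: the `s* = 2` theorem).

* `sum_sum_neg_transpose` — for the base's completed symbols `n(b,b') = [(P_{b'}/P_b) = −1]` (reciprocity `n(b',b) = n(b,b') + m_b m_{b'}`,
  `bz_neg_swap`): `⟨a, Lc⟩ + ⟨La, c⟩ = ⟨m,a⟩⟨m,c⟩ + ⟨m⊙a, c⟩` with `(Lc)_b = ∑_{b'} n(b,b')(c_{b'} + c_b)` (difference form).
* `sum_L_eq` — `∑_b (Lc)_b = (|m| + 1)·⟨m, c⟩`.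
* ★ `leftKernel_pairing` — if `(u¹, w¹)` is a VIRTUAL KERNEL PAIR (`(L + D_m)u¹ + D_d w¹ = 0`, `D_m u¹ + L w¹ = 0`) then for all `x, y`:
  `⟨w¹, (L + D_m)x + D_d y⟩ + ⟨u¹ + γ·1, D_m x + L y⟩ = 0`, `γ = ⟨m, w¹⟩` — i.e. `(w¹, u¹ + γ1)` is a LEFT kernel vector of the base block
  `N_B` of the virtual twist; `inner_m_eq` — `⟨m, u¹⟩ = (|m|+1)γ`.

HONEST FRAMING: linear algebra over `𝔽₂` about the base datum only; the crux (C⁺), its stubs and BSD untouched; nothing closed. THEOREMS ONLY.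
Reference: [HeathBrown1994] appendix (Monsky), typescript pp. 39–41 (the matrix `A` and reciprocity).
-/

namespace Summit.BirchSwinnertonDyer.BirchSwinnertonDyer.Theorems.SymbolicMonsky

open Matrix

namespace SymbData

variable {b : ℕ} (base : SymbData b)

/-- `bz` is idempotent. -/
private theorem bz_mul_self (x : Bool) : bz x * bz x = bz x := by cases x <;> decide

/-- In `𝔽₂`: `n + (n + x) = x`. -/
private theorem add_add_cancel_left' (n x : ZMod 2) : n + (n + x) = x := by
  rw [← add_assoc, zmod_two_add_self, zero_add]

/-- Removing one term from a sum, in characteristic two: `∑_{j ≠ i} g j = ∑_j g j + g i`. -/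
private theorem sum_ite_ne_eq (i : Fin b) (g : Fin b → ZMod 2) :
    (∑ j, if i = j then 0 else g j) = (∑ j, g j) + g i := by
  classical
  have h : (∑ j, g j) = (∑ j, if i = j then g j else 0) + ∑ j, if i = j then 0 else g j := by
    rw [← Finset.sum_add_distrib]
    exact Finset.sum_congr rfl fun j _ => by by_cases hij : i = j <;> simp [hij]
  rw [Finset.sum_ite_eq Finset.univ i, if_pos (Finset.mem_univ i)] at h
  rw [h]
  generalize (∑ j, if i = j then (0 : ZMod 2) else g j) = S
  rw [add_comm (g i) S, add_assoc, zmod_two_add_self, add_zero]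

/-- Symmetrised completed symbols: `n(i,j) + n(j,i) = [i ≠ j]·m_i m_j`. -/
theorem bz_neg_add_bz_neg (i j : Fin b) :
    bz (base.neg i j) + bz (base.neg j i) =
      if i = j then 0 else bz (negNegOne (base.cls i)) * bz (negNegOne (base.cls j)) := by
  by_cases h : i = j
  · subst h; rw [if_pos rfl, zmod_two_add_self]
  · rw [if_neg h, base.bz_neg_swap h, bz_and_mul, add_add_cancel_left']

/-- **Transpose identity** of the base Laplacian in difference form: `⟨a, Lc⟩ + ⟨c, La⟩ = ⟨m,a⟩⟨m,c⟩ + ⟨m⊙a, c⟩`. -/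
theorem sum_sum_neg_transpose (a c : Fin b → ZMod 2) :
    (∑ i, a i * ∑ j, bz (base.neg i j) * (c j + c i)) + (∑ i, c i * ∑ j, bz (base.neg i j) * (a j + a i)) =
      (∑ i, bz (negNegOne (base.cls i)) * a i) * (∑ i, bz (negNegOne (base.cls i)) * c i) +
        ∑ i, bz (negNegOne (base.cls i)) * a i * c i := by
  classical
  -- T(p,q) = X(p,q) + D(p,q)
  have hT : ∀ p q : Fin b → ZMod 2, (∑ i, p i * ∑ j, bz (base.neg i j) * (q j + q i)) =
      (∑ i, ∑ j, bz (base.neg i j) * p i * q j) + ∑ i, p i * q i * ∑ j, bz (base.neg i j) := by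
    intro p q
    rw [← Finset.sum_add_distrib]
    refine Finset.sum_congr rfl fun i _ => ?_
    rw [Finset.mul_sum, Finset.mul_sum, ← Finset.sum_add_distrib]
    exact Finset.sum_congr rfl fun j _ => by ring
  rw [hT a c, hT c a]
  -- the D terms cancel, the X terms symmetrise
  have hD : (∑ i, c i * a i * ∑ j, bz (base.neg i j)) = ∑ i, a i * c i * ∑ j, bz (base.neg i j) :=
    Finset.sum_congr rfl fun i _ => by ring
  have hX : (∑ i, ∑ j, bz (base.neg i j) * c i * a j) = ∑ i, ∑ j, bz (base.neg j i) * a i * c j := by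
    rw [Finset.sum_comm]
    exact Finset.sum_congr rfl fun i _ => Finset.sum_congr rfl fun j _ => by ring
  rw [hD, hX]
  have hS : (∑ i, ∑ j, bz (base.neg i j) * a i * c j) + (∑ i, ∑ j, bz (base.neg j i) * a i * c j) =
      ∑ i, ∑ j, if i = j then 0 else bz (negNegOne (base.cls i)) * bz (negNegOne (base.cls j)) * a i * c j := by
    rw [← Finset.sum_add_distrib]
    refine Finset.sum_congr rfl fun i _ => ?_
    rw [← Finset.sum_add_distrib]
    refine Finset.sum_congr rfl fun j _ => ?_
    rw [show bz (base.neg i j) * a i * c j + bz (base.neg j i) * a i * c j = (bz (base.neg i j) + bz (base.neg j i)) * (a i * c j)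
      from by ring, base.bz_neg_add_bz_neg]
    by_cases h : i = j <;> simp [h, mul_assoc]
  -- rearrange: (X + D) + (X' + D) = X + X'
  have hcancel : ∀ X X' D : ZMod 2, (X + D) + (X' + D) = X + X' := fun X X' D => by
    calc (X + D) + (X' + D) = (X + X') + (D + D) := by ring
      _ = X + X' := by rw [zmod_two_add_self, add_zero]
  rw [hcancel, hS]
  -- remove the diagonal and factor
  have hrow : ∀ i, (∑ j, if i = j then 0 else bz (negNegOne (base.cls i)) * bz (negNegOne (base.cls j)) * a i * c j) =
      (∑ j, bz (negNegOne (base.cls i)) * bz (negNegOne (base.cls j)) * a i * c j) + bz (negNegOne (base.cls i)) * a i * c i := by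
    intro i
    rw [sum_ite_ne_eq i (fun j => bz (negNegOne (base.cls i)) * bz (negNegOne (base.cls j)) * a i * c j)]
    congr 1
    rw [show bz (negNegOne (base.cls i)) * bz (negNegOne (base.cls i)) * a i * c i =
      (bz (negNegOne (base.cls i)) * bz (negNegOne (base.cls i))) * a i * c i from by ring, bz_mul_self]
  rw [Finset.sum_congr rfl fun i _ => hrow i, Finset.sum_add_distrib, Finset.sum_mul_sum]
  congr 1
  exact Finset.sum_congr rfl fun i _ => Finset.sum_congr rfl fun j _ => by ring

/-- `L 1 = 0` in difference form. -/
theorem sum_neg_mul_one_add_one (i : Fin b) : (∑ j, bz (base.neg i j) * ((1 : ZMod 2) + 1)) = 0 :=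
  Finset.sum_eq_zero fun j _ => by rw [zmod_two_add_self, mul_zero]

/-- **Column sums of the Laplacian**: `∑_b (Lc)_b = (|m| + 1)·⟨m, c⟩`. -/
theorem sum_L_eq (c : Fin b → ZMod 2) :
    (∑ i, ∑ j, bz (base.neg i j) * (c j + c i)) =
      ((∑ i, bz (negNegOne (base.cls i))) + 1) * ∑ i, bz (negNegOne (base.cls i)) * c i := by
  have h := base.sum_sum_neg_transpose (fun _ => 1) c
  simp only [one_mul, mul_one, base.sum_neg_mul_one_add_one, mul_zero, Finset.sum_const_zero, add_zero] at h
  rw [h]; ring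

/-- `⟨m, u¹⟩ = (|m|+1)·⟨m, w¹⟩` for a pair with `D_m u¹ + L w¹ = 0` (sum the coordinates). -/
theorem inner_m_eq (u w : Fin b → ZMod 2)
    (hE2 : ∀ i, bz (negNegOne (base.cls i)) * u i + ∑ j, bz (base.neg i j) * (w j + w i) = 0) :
    (∑ i, bz (negNegOne (base.cls i)) * u i) =
      ((∑ i, bz (negNegOne (base.cls i))) + 1) * ∑ i, bz (negNegOne (base.cls i)) * w i := by
  have h : (∑ i, (bz (negNegOne (base.cls i)) * u i + ∑ j, bz (base.neg i j) * (w j + w i))) = 0 :=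
    Finset.sum_eq_zero fun i _ => hE2 i
  rw [Finset.sum_add_distrib, base.sum_L_eq w] at h
  exact (zmod_two_eq_iff_add_eq_zero _ _).mpr h

/-- ★ **Left-kernel pairing.** If `(u¹, w¹)` is a virtual kernel pair of the base (`(L + D_m)u¹ + D_d w¹ = 0` and `D_m u¹ + L w¹ = 0`), then for
every `x, y`: `⟨w¹, (L+D_m)x + D_d y⟩ + ⟨u¹ + γ1, D_m x + L y⟩ = 0` with `γ = ⟨m, w¹⟩` — the pair `(w¹, u¹ + γ1)` annihilates the image of
the base block of the virtual twist. [folklore] -/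
theorem leftKernel_pairing (u w : Fin b → ZMod 2)
    (hE1 : ∀ i, (∑ j, bz (base.neg i j) * (u j + u i)) + bz (negNegOne (base.cls i)) * u i + bz (negTwo (base.cls i)) * w i = 0)
    (hE2 : ∀ i, bz (negNegOne (base.cls i)) * u i + ∑ j, bz (base.neg i j) * (w j + w i) = 0)
    (x y : Fin b → ZMod 2) :
    (∑ i, w i * ((∑ j, bz (base.neg i j) * (x j + x i)) + bz (negNegOne (base.cls i)) * x i + bz (negTwo (base.cls i)) * y i)) +
      (∑ i, (u i + ∑ l, bz (negNegOne (base.cls l)) * w l) * (bz (negNegOne (base.cls i)) * x i + ∑ j, bz (base.neg i j) * (y j + y i))) = 0 := by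
  set γ := ∑ l, bz (negNegOne (base.cls l)) * w l with hγ
  set μ := ∑ i, bz (negNegOne (base.cls i)) with hμ
  have two : (2 : ZMod 2) = 0 := by decide
  -- canonical atoms
  set A := ∑ i, w i * ∑ j, bz (base.neg i j) * (x j + x i) with hA
  set D := ∑ i, (u i + γ) * ∑ j, bz (base.neg i j) * (y j + y i) with hD
  set P := ∑ i, bz (negNegOne (base.cls i)) * u i * x i with hP
  set C := ∑ i, bz (negNegOne (base.cls i)) * w i * x i with hC
  set X := ∑ i, bz (negNegOne (base.cls i)) * x i with hX
  set Wd := ∑ i, bz (negTwo (base.cls i)) * w i * y i with hWd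
  set Qy := ∑ i, bz (negNegOne (base.cls i)) * u i * y i with hQy
  set Y := ∑ i, bz (negNegOne (base.cls i)) * y i with hY
  set U := ∑ i, bz (negNegOne (base.cls i)) * u i with hU
  -- the rows of the kernel pair
  have hLw : ∀ i, (∑ j, bz (base.neg i j) * (w j + w i)) = bz (negNegOne (base.cls i)) * u i := fun i =>
    ((zmod_two_eq_iff_add_eq_zero _ _).mpr ((add_comm _ _).trans (hE2 i))).symm ▸ rfl
  have hLu : ∀ i, (∑ j, bz (base.neg i j) * ((u j + γ) + (u i + γ))) =
      bz (negNegOne (base.cls i)) * u i + bz (negTwo (base.cls i)) * w i := by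
    intro i
    have e : (∑ j, bz (base.neg i j) * ((u j + γ) + (u i + γ))) = ∑ j, bz (base.neg i j) * (u j + u i) :=
      Finset.sum_congr rfl fun j _ => by
        rw [show u j + γ + (u i + γ) = (u j + u i) + (γ + γ) from by ring, zmod_two_add_self, add_zero]
    rw [e]
    have h := hE1 i
    refine (zmod_two_eq_iff_add_eq_zero _ _).mpr ?_
    calc (∑ j, bz (base.neg i j) * (u j + u i)) + (bz (negNegOne (base.cls i)) * u i + bz (negTwo (base.cls i)) * w i)
        = (∑ j, bz (base.neg i j) * (u j + u i)) + bz (negNegOne (base.cls i)) * u i + bz (negTwo (base.cls i)) * w i := by ring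
      _ = 0 := h
  -- transpose identities
  have t1 := base.sum_sum_neg_transpose w x
  have t2 := base.sum_sum_neg_transpose (fun i => u i + γ) y
  have t3 := base.inner_m_eq u w hE2
  simp only [hLw] at t1
  simp only [hLu] at t2
  -- normalise the atoms in t1, t2, t3
  have n1 : (∑ i, x i * (bz (negNegOne (base.cls i)) * u i)) = P :=
    Finset.sum_congr rfl fun i _ => by ring
  have n2 : (∑ i, y i * (bz (negNegOne (base.cls i)) * u i + bz (negTwo (base.cls i)) * w i)) = Qy + Wd := by
    rw [hQy, hWd, ← Finset.sum_add_distrib]; exact Finset.sum_congr rfl fun i _ => by ring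
  have n3 : (∑ i, bz (negNegOne (base.cls i)) * (u i + γ)) = U + μ * γ := by
    rw [hU, hμ, Finset.sum_mul, ← Finset.sum_add_distrib]; exact Finset.sum_congr rfl fun i _ => by ring
  have n4 : (∑ i, bz (negNegOne (base.cls i)) * (u i + γ) * y i) = Qy + γ * Y := by
    rw [hQy, hY, Finset.mul_sum, ← Finset.sum_add_distrib]; exact Finset.sum_congr rfl fun i _ => by ring
  rw [n1] at t1
  rw [n2, n3, n4] at t2
  -- the goal in atoms
  have g1 : (∑ i, w i * ((∑ j, bz (base.neg i j) * (x j + x i)) + bz (negNegOne (base.cls i)) * x i +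
      bz (negTwo (base.cls i)) * y i)) = A + C + Wd := by
    rw [hA, hC, hWd, ← Finset.sum_add_distrib, ← Finset.sum_add_distrib]
    exact Finset.sum_congr rfl fun i _ => by ring
  have g2 : (∑ i, (u i + γ) * (bz (negNegOne (base.cls i)) * x i + ∑ j, bz (base.neg i j) * (y j + y i))) =
      P + γ * X + D := by
    rw [hP, hX, hD, Finset.mul_sum, ← Finset.sum_add_distrib, ← Finset.sum_add_distrib]
    exact Finset.sum_congr rfl fun i _ => by ring
  rw [g1, g2]
  rw [← hA, ← hγ, ← hX, ← hC] at t1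
  rw [← hD, ← hY] at t2
  rw [← hU, ← hμ, ← hγ] at t3
  linear_combination t1 + t2 + Y * t3 + (C + γ * X + μ * γ * Y + γ * Y) * two

end SymbData

end Summit.BirchSwinnertonDyer.BirchSwinnertonDyer.Theorems.SymbolicMonsky
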